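import Literature.NumberTheory.LFunctions.TatuzawaTheorem
import Literature.NumberTheory.LFunctions.DeuringZeroSpacingPhenomenon
import HarnessLib

/-!
# An explicit, kernel-proved Page-type repulsion of real zeros from `s = 1`:
# `1 − β ≥ 1/(400 √q (log q)²)` for every real primitive `χ` mod `q ≥ 3`

Topic `Literature/NumberTheory/LFunctions`. Everything in this file is PROVED (theorems only; no
definition, no named fact). Our own proof, with an explicit (weak) constant, of the classical
effective bound for the exceptional zero — Page 1935; Davenport, *Multiplicative Number Theory*,
Ch. 14 (12): "`β₁ < 1 − c/(q^{1/2}(log q)²)`"; quoted e.g. as (6.2) of Friedlander–Iwaniec, Acta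
Arith. 209 (2023): "`1 − β ≫ q^{−1/2}(log q)^{−2}`" [FriedlanderIwaniec2023SelbergIrregular] — from
two kernel theorems of the tree:

* the CLASS-NUMBER-FORMULA FLOORS `√D·‖L(1,χ)‖ ≥ 2π/9` (odd) and `≥ 3/4` (even, `D > 1`) for every
  real primitive `χ` (`sqrt_mul_norm_LFunction_one_ge_of_odd/_of_even`,
  `DeuringZeroSpacingPhenomenon.lean`, rc-cond g4);
* the MEAN-VALUE BOUND AT A REAL ZERO `‖L(1,χ)‖ ≤ (1 − β)·2q^{4r} Z_r/r`, `Z_r = ∑ n^{−1−2r} ≤ 1 + 1/(2r)`,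
  for `β ≥ 1 − r`, `0 < r ≤ 1/8` (`Siegel.norm_LFunction_one_le_of_realZero`,
  `Siegel.tsum_succ_rpow_neg_sub_one_le`, `TatuzawaTheorem.lean`; Montgomery–Vaughan, proof of
  Corollary 11.15).

With `r = 1/(4 log q)` (`q ≥ 8`, so `r ≤ 1/8`; `q^{4r} = e`, `Z_r ≤ 1 + 2 log q ≤ (5/2) log q`):
`‖L(1,χ)‖ ≤ 20e (1 − β)(log q)² < 55 (1 − β)(log q)²`, whence
`1 − β ≥ (2π/9)/(55 √q (log q)²) > 1/(80 √q (log q)²)` when `β ≥ 1 − r`, and `1 − β > r = 1/(4 log q)`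
otherwise; for `3 ≤ q ≤ 7` the choice `r = 1/8` gives `1 − β ≥ ‖L(1,χ)‖/(80√q) ≥ 0.69/(80 q)`, still
`≥ 1/(400 √q (log q)²)`. Main results:

* `RealZeroRepulsion.one_sub_realZero_ge_explicit` — **for every `q ≥ 3`, every primitive quadratic
  `χ` mod `q` and every real `β` with `L(β, χ) = 0`: `1/(400·√q·(log q)²) ≤ 1 − β`;**
* `RealZeroRepulsion.one_sub_realZero_ge_explicit_of_eight_le` — the constant `1/80` for `q ≥ 8`;
* `RealZeroRepulsion.isSiegelZero_quality_le` — on the column's predicate: a Siegel zero of quality `η`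
  (Tao–Teräväinen) attached to a conductor `q ≥ 3` has `η ≤ 400 √q log q` (EFFECTIVE and
  kernel-certified, against Siegel's INEFFECTIVE `η ≪_ε q^ε`, tree `SiegelZeroQuality.eta_le_mul_rpow`).

The constants are far from print (Bordignon 2019/2020: `λ = 800` odd / `100` even in
`β ≤ 1 − λ/(√q log²q)` for `q > 4·10⁵`, tree fact `BGTZ2025.theorem28_bordignon`;
Ralaivaosaona–Razakarinoro 2026: `1 − β > 6.035/√d`, odd, `d > 3·10⁸`, tree fact); the point is that
this one is a THEOREM of the kernel, uniform in `q ≥ 3` and both parities, resting on nothing unproved.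

LABEL: instrument / comparator (kernel-certified, weak constant). WHAT THIS IS NOT: not competitive
with print; no certified-range input is used (the leaves `NoRealZeroUpTo_*` give the whole of
`(0, 1)` below their `Q`).

## References

* [DavenportMNT1980] H. Davenport, *Multiplicative Number Theory*, 2nd ed., GTM 74, Springer 1980,
  Ch. 14, (12).
* [FriedlanderIwaniec2023SelbergIrregular] J. B. Friedlander, H. Iwaniec, Acta Arith. 209 (2023),
  §6 (6.2).
* [MontgomeryVaughan2007] H. L. Montgomery, R. C. Vaughan, *Multiplicative Number Theory I*, §11.2,
  proof of Corollary 11.15.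
* [TaoTeravainen2021] Definition 1.4 (quality of a Siegel zero).
-/

noncomputable section

open Real
open Literature.Barriers.Parity

namespace Literature.NumberTheory.LFunctions

namespace RealZeroRepulsion

/-- The kernel floor `‖L(1,χ)‖ ≥ 0.69/√q` for every real primitive `χ` mod `q ≥ 3` (both parities:
`2π/9 > 0.69` and `3/4 > 0.69`). [cite: MontgomeryVaughan2007, §4.3 (class number formula)] -/
theorem norm_LFunction_one_ge {q : ℕ} [NeZero q] (hq : 3 ≤ q) {χ : DirichletCharacter ℂ q}
    (hprim : χ.IsPrimitive) (hquad : χ.IsQuadratic) :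
    (69 / 100) / Real.sqrt q ≤ ‖χ.LFunction 1‖ := by
  have hq0 : (0 : ℝ) < q := by exact_mod_cast (show 0 < q by omega)
  have hsq : 0 < Real.sqrt q := Real.sqrt_pos.mpr hq0
  rw [div_le_iff₀ hsq, mul_comm]
  rcases χ.even_or_odd with heven | hodd
  · have h := sqrt_mul_norm_LFunction_one_ge_of_even (by omega) hprim hquad heven
    linarith
  · have h := sqrt_mul_norm_LFunction_one_ge_of_odd hprim hquad hodd
    have hpi : 3.14 < Real.pi := Real.pi_gt_d2
    nlinarith

/-- The mean-value bound with the tail sum estimated: for `χ ≠ χ₀`, `0 < r ≤ 1/8`, a real zero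
`β ≥ 1 − r`: `‖L(1,χ)‖ ≤ (1 − β) · 2 q^{4r} (1 + 1/(2r))/r`. [cite: MontgomeryVaughan2007, §11.2 Corollary 11.15 (proof)] -/
theorem norm_LFunction_one_le {q : ℕ} [NeZero q] (χ : DirichletCharacter ℂ q) (hχ : χ ≠ 1)
    {r : ℝ} (hr : 0 < r) (hr1 : r ≤ 1 / 8) {β : ℝ} (hβr : 1 - r ≤ β) (hzero : χ.LFunction β = 0) :
    ‖χ.LFunction 1‖ ≤ (1 - β) * (2 * (q : ℝ) ^ (4 * r) * (1 + 1 / (2 * r)) / r) := by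
  have hmv := Siegel.norm_LFunction_one_le_of_realZero χ hχ hr hr1 hβr hzero
  have hZ : ∑' n : ℕ, ((n + 1 : ℕ) : ℝ) ^ (-(1 + 2 * r)) ≤ 1 + 1 / (2 * r) := by
    have h := Siegel.tsum_succ_rpow_neg_sub_one_le (δ := 2 * r) (by positivity)
    have e : ∀ m : ℕ, ((m + 1 : ℕ) : ℝ) ^ (-(2 * r) - 1) = ((m + 1 : ℕ) : ℝ) ^ (-(1 + 2 * r)) := by
      intro m; congr 1; ring
    rwa [tsum_congr e] at h
  have hβ1 : β < 1 := by
    by_contra hcon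
    exact DirichletCharacter.LFunction_ne_zero_of_one_le_re χ (Or.inl hχ) (s := β)
      (by simp; linarith) hzero
  have hq0 : (0 : ℝ) < q := by exact_mod_cast NeZero.pos q
  have hpow : 0 < (q : ℝ) ^ (4 * r) := Real.rpow_pos_of_pos hq0 _
  calc ‖χ.LFunction 1‖
      ≤ (1 - β) * (2 * (q : ℝ) ^ (4 * r) * (∑' n : ℕ, ((n + 1 : ℕ) : ℝ) ^ (-(1 + 2 * r))) / r) := hmv
    _ ≤ (1 - β) * (2 * (q : ℝ) ^ (4 * r) * (1 + 1 / (2 * r)) / r) := by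
        have h1β : 0 ≤ 1 - β := by linarith
        apply mul_le_mul_of_nonneg_left _ h1β
        apply div_le_div_of_nonneg_right _ hr.le
        exact mul_le_mul_of_nonneg_left hZ (by positivity)

/-- A primitive character of modulus `q ≥ 2` is not principal. [folklore] -/
private theorem ne_one_of_isPrimitive {q : ℕ} [NeZero q] (hq : 2 ≤ q) {χ : DirichletCharacter ℂ q}
    (hprim : χ.IsPrimitive) : χ ≠ 1 := by
  intro hχ
  have hcond : χ.conductor = q := (DirichletCharacter.isPrimitive_def χ).mp hprim
  rw [hχ, DirichletCharacter.conductor_one] at hcond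
  omega

/-- **Explicit repulsion for `q ≥ 8`, constant `1/80`**: every real zero `β` of `L(s, χ)`, `χ`
primitive quadratic mod `q ≥ 8`, has `1/(80 √q (log q)²) ≤ 1 − β`. (`r = 1/(4 log q)`:
`q^{4r} = e < 2.72`, `1 + 1/(2r) = 1 + 2 log q ≤ (5/2) log q`, so
`‖L(1,χ)‖ ≤ (1−β)·8e·(5/2)(log q)² < 55(1−β)(log q)²`; with `‖L(1,χ)‖ ≥ 0.69/√q`.)
[cite: DavenportMNT1980, Ch. 14 (12)] [cite: FriedlanderIwaniec2023SelbergIrregular, §6 (6.2)] -/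
theorem one_sub_realZero_ge_explicit_of_eight_le {q : ℕ} [NeZero q] (hq : 8 ≤ q)
    {χ : DirichletCharacter ℂ q} (hprim : χ.IsPrimitive) (hquad : χ.IsQuadratic)
    {β : ℝ} (hzero : χ.LFunction β = 0) :
    1 / (80 * Real.sqrt q * Real.log q ^ 2) ≤ 1 - β := by
  have hq8 : (8 : ℝ) ≤ q := by exact_mod_cast hq
  have hq0 : (0 : ℝ) < q := by linarith
  have hne : χ ≠ 1 := ne_one_of_isPrimitive (by omega) hprim
  -- `log q ≥ log 8 > 2`
  have hL2 : 2 < Real.log q := by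
    have h8 : 2 < Real.log 8 := by
      rw [show (8 : ℝ) = 2 ^ 3 by norm_num, Real.log_pow]
      have := Real.log_two_gt_d9; push_cast; linarith
    exact lt_of_lt_of_le h8 (Real.log_le_log (by norm_num) hq8)
  have hL0 : 0 < Real.log q := by linarith
  have hsq : 0 < Real.sqrt q := Real.sqrt_pos.mpr hq0
  have hsq1 : 1 ≤ Real.sqrt q := by
    rw [show (1 : ℝ) = Real.sqrt 1 by simp]; exact Real.sqrt_le_sqrt (by linarith)
  -- floor
  have hfloor := norm_LFunction_one_ge (by omega) hprim hquad
  -- `β < 1`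
  have hβ1 : β < 1 := by
    by_contra hcon
    exact DirichletCharacter.LFunction_ne_zero_of_one_le_re χ (Or.inl hne) (s := β)
      (by simp; linarith) hzero
  -- target positivity facts
  have hden : 0 < 80 * Real.sqrt q * Real.log q ^ 2 := by positivity
  set r : ℝ := 1 / (4 * Real.log q) with hrdef
  have hr0 : 0 < r := by positivity
  have hr8 : r ≤ 1 / 8 := by
    rw [hrdef, div_le_div_iff₀ (by positivity) (by norm_num)]; linarith
  by_cases hfar : β < 1 - r
  · -- far zero: `1 − β > r = 1/(4 log q) ≥ 1/(80 √q log² q)`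
    have h1 : 1 / (80 * Real.sqrt q * Real.log q ^ 2) ≤ r := by
      rw [hrdef, div_le_div_iff₀ hden (by positivity)]
      nlinarith [mul_pos hsq hL0]
    linarith
  · rw [not_lt] at hfar
    have hmv := norm_LFunction_one_le χ hne hr0 hr8 hfar hzero
    -- `q^{4r} = e`
    have hq4r : (q : ℝ) ^ (4 * r) = Real.exp 1 := by
      rw [hrdef, Real.rpow_def_of_pos hq0]
      congr 1; field_simp
    have he : Real.exp 1 < 2.72 := by
      have := Real.exp_one_lt_d9; linarith
    -- `1 + 1/(2r) = 1 + 2 log q ≤ (5/2) log q`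
    have h2r : 1 + 1 / (2 * r) = 1 + 2 * Real.log q := by rw [hrdef]; field_simp; ring
    have hfac : 2 * (q : ℝ) ^ (4 * r) * (1 + 1 / (2 * r)) / r ≤ 55 * Real.log q ^ 2 := by
      rw [hq4r, h2r, hrdef, div_div_eq_mul_div, div_one]
      have h1 : 1 + 2 * Real.log q ≤ 5 / 2 * Real.log q := by linarith
      have hpos : 0 ≤ 2 * Real.exp 1 := by positivity
      nlinarith [Real.exp_pos 1, mul_le_mul_of_nonneg_left h1 hpos]
    have h1β : 0 ≤ 1 - β := by linarith
    have hup : ‖χ.LFunction 1‖ ≤ (1 - β) * (55 * Real.log q ^ 2) :=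
      hmv.trans (mul_le_mul_of_nonneg_left hfac h1β)
    -- combine with the floor `0.69/√q ≤ ‖L(1,χ)‖`
    have key : 69 / 100 / Real.sqrt q ≤ (1 - β) * (55 * Real.log q ^ 2) := hfloor.trans hup
    rw [div_le_iff₀ hsq] at key
    rw [div_le_iff₀ hden]
    nlinarith [mul_pos hsq (pow_pos hL0 2)]

/-- **Explicit repulsion, all conductors**: every real zero `β` of `L(s, χ)`, `χ` primitive
quadratic mod `q ≥ 3`, satisfies `1/(400 √q (log q)²) ≤ 1 − β`. For `q ≥ 8` this is the previous
theorem; for `3 ≤ q ≤ 7` take `r = 1/8`: a zero `β ≥ 7/8` gives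
`‖L(1,χ)‖ ≤ (1−β)·80 q^{1/2} ≤ (1 − β)·80√q`, and `‖L(1,χ)‖ ≥ 0.69/√q`, so `1 − β ≥ 0.69/(80 q)`,
which exceeds `1/(400√q(log q)²)` for `3 ≤ q ≤ 7` (`log q ≥ log 3 > 1.09`).
[cite: DavenportMNT1980, Ch. 14 (12)] [cite: FriedlanderIwaniec2023SelbergIrregular, §6 (6.2)] -/
theorem one_sub_realZero_ge_explicit {q : ℕ} [NeZero q] (hq : 3 ≤ q)
    {χ : DirichletCharacter ℂ q} (hprim : χ.IsPrimitive) (hquad : χ.IsQuadratic)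
    {β : ℝ} (hzero : χ.LFunction β = 0) :
    1 / (400 * Real.sqrt q * Real.log q ^ 2) ≤ 1 - β := by
  have hq3 : (3 : ℝ) ≤ q := by exact_mod_cast hq
  have hq0 : (0 : ℝ) < q := by linarith
  have hne : χ ≠ 1 := ne_one_of_isPrimitive (by omega) hprim
  have hlog3 : 1.09 < Real.log q := by
    have h3 : 1.09 < Real.log 3 := by
      rw [Real.lt_log_iff_exp_lt (by norm_num)]
      have h := Real.exp_one_lt_d9
      -- `exp 1.09 = exp 1 · exp 0.09 < 2.7183 · 1.1 < 3` via `exp x ≤ 1/(1−x)` for `x < 1`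
      have h09 : Real.exp (0.09 : ℝ) < 1.1 := by
        have := Real.exp_bound_div_one_sub_of_interval' (x := (0.09 : ℝ)) (by norm_num) (by norm_num)
        have h2 : (1 : ℝ) / (1 - 0.09) < 1.1 := by norm_num
        linarith
      have : Real.exp (1.09 : ℝ) = Real.exp 1 * Real.exp 0.09 := by
        rw [← Real.exp_add]; norm_num
      rw [this]; nlinarith [Real.exp_pos (0.09 : ℝ), Real.exp_pos (1 : ℝ)]
    exact lt_of_lt_of_le h3 (Real.log_le_log (by norm_num) hq3)
  have hL0 : 0 < Real.log q := by linarith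
  have hsq : 0 < Real.sqrt q := Real.sqrt_pos.mpr hq0
  have hsq3 : Real.sqrt 3 ≤ Real.sqrt q := Real.sqrt_le_sqrt hq3
  have hsq17 : 1.7 < Real.sqrt 3 := by
    rw [show (1.7 : ℝ) = Real.sqrt (1.7 ^ 2) by rw [Real.sqrt_sq (by norm_num)]]
    exact Real.sqrt_lt_sqrt (by norm_num) (by norm_num)
  have hden : 0 < 400 * Real.sqrt q * Real.log q ^ 2 := by positivity
  by_cases h8 : 8 ≤ q
  · have h := one_sub_realZero_ge_explicit_of_eight_le h8 hprim hquad hzero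
    have hmono : 1 / (400 * Real.sqrt q * Real.log q ^ 2) ≤ 1 / (80 * Real.sqrt q * Real.log q ^ 2) :=
      one_div_le_one_div_of_le (by positivity) (by nlinarith [mul_pos hsq (pow_pos hL0 2)])
    exact hmono.trans h
  · -- `3 ≤ q ≤ 7`
    have hq7 : (q : ℝ) ≤ 7 := by exact_mod_cast (show q ≤ 7 by omega)
    have hβ1 : β < 1 := by
      by_contra hcon
      exact DirichletCharacter.LFunction_ne_zero_of_one_le_re χ (Or.inl hne) (s := β)
        (by simp; linarith) hzero
    have hfloor := norm_LFunction_one_ge hq hprim hquad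
    by_cases hfar : β < 1 - 1 / 8
    · -- `1 − β > 1/8`
      have h1 : 1 / (400 * Real.sqrt q * Real.log q ^ 2) ≤ 1 / 8 :=
        one_div_le_one_div_of_le (by norm_num) (by nlinarith [mul_pos hsq (pow_pos hL0 2)])
      linarith
    · rw [not_lt] at hfar
      have hmv := norm_LFunction_one_le χ hne (r := 1 / 8) (by norm_num) le_rfl hfar hzero
      -- `2 q^{1/2} (1 + 4)/(1/8) = 80 √q`
      have hq48 : (q : ℝ) ^ (4 * (1 / 8 : ℝ)) = Real.sqrt q := by
        rw [show 4 * (1 / 8 : ℝ) = 1 / 2 by norm_num, Real.sqrt_eq_rpow]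
      have hfac : 2 * (q : ℝ) ^ (4 * (1 / 8 : ℝ)) * (1 + 1 / (2 * (1 / 8 : ℝ))) / (1 / 8 : ℝ) =
          80 * Real.sqrt q := by
        rw [hq48]; norm_num; ring
      rw [hfac] at hmv
      have key : 69 / 100 / Real.sqrt q ≤ (1 - β) * (80 * Real.sqrt q) := hfloor.trans hmv
      rw [div_le_iff₀ hsq] at key
      -- `(1−β) · 80 q ≥ 0.69` (as `√q·√q = q`), and `0.69/(80 q) ≥ 1/(400 √q log² q)` for `q ≤ 7`
      have hqq : Real.sqrt q * Real.sqrt q = q := Real.mul_self_sqrt hq0.le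
      rw [div_le_iff₀ hden]
      nlinarith [mul_pos hsq (pow_pos hL0 2), hqq, mul_pos hsq hL0]

/-- **The quality of a Siegel zero is at most `400 √q log q`** (kernel-certified and EFFECTIVE): if
`χ` mod `q ≥ 3` carries a Siegel zero of quality `η` (Tao–Teräväinen: `L(1 − 1/(η log q), χ) = 0`,
`χ` primitive quadratic), then `η ≤ 400 √q log q`. Compare Siegel's ineffective `η ≪_ε q^ε`
(`SiegelZeroQuality.eta_le_mul_rpow`). [cite: TaoTeravainen2021, Definition 1.4 and (1.4)]
[cite: DavenportMNT1980, Ch. 14 (12)] -/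
theorem isSiegelZero_quality_le {q : ℕ} [NeZero q] (hq : 3 ≤ q) {χ : DirichletCharacter ℂ q}
    {η : ℝ} (hS : IsSiegelZero χ η) : η ≤ 400 * Real.sqrt q * Real.log q := by
  obtain ⟨hprim, hquad, h10, hzero⟩ := hS
  have hq3 : (3 : ℝ) ≤ q := by exact_mod_cast hq
  have hq0 : (0 : ℝ) < q := by linarith
  have hL0 : 0 < Real.log q := Real.log_pos (by linarith)
  have hsq : 0 < Real.sqrt q := Real.sqrt_pos.mpr hq0
  have hη : 0 < η := by linarith
  have h := one_sub_realZero_ge_explicit hq hprim hquad hzero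
  -- `1 − β = 1/(η log q)`
  have h1β : 1 - (1 - 1 / (η * Real.log q)) = 1 / (η * Real.log q) := by ring
  rw [h1β] at h
  rw [div_le_div_iff₀ (by positivity) (by positivity)] at h
  -- `η log q ≤ 400 √q log² q`
  have : η * Real.log q ≤ 400 * Real.sqrt q * Real.log q ^ 2 := by linarith
  have := div_le_div_of_nonneg_right this hL0.le
  rw [mul_div_assoc, div_self hL0.ne', mul_one] at this
  calc η ≤ 400 * Real.sqrt q * Real.log q ^ 2 / Real.log q := this
    _ = 400 * Real.sqrt q * Real.log q := by field_simp


/-! ### The explicit upper half of Montgomery–Vaughan (11.10) and the quality ↔ `η(D)` dictionary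
(appended 2026-08-26) -/

/-- **Explicit (11.10), upper half**: for ANY non-principal `χ` mod `q ≥ 8` and a real zero `β` with
`β ≥ 1 − 1/(4 log q)`: `‖L(1, χ)‖ ≤ 55 (1 − β)(log q)²` (mean value at `r = 1/(4 log q)`:
`2q^{4r}(1 + 1/(2r))/r = 8e log q (1 + 2 log q) ≤ 20e (log q)² < 55 (log q)²`). The tree's
`MontgomeryVaughan2007_thm11_4_LOne_exceptional_holds` has the same shape with an inexplicit `C₂`.
[cite: MontgomeryVaughan2007, Theorem 11.4 (11.10) and §11.2 Corollary 11.15 (proof)] -/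
theorem norm_LFunction_one_le_mul_log_sq {q : ℕ} [NeZero q] (hq : 8 ≤ q) (χ : DirichletCharacter ℂ q)
    (hχ : χ ≠ 1) {β : ℝ} (hβ : 1 - 1 / (4 * Real.log q) ≤ β) (hzero : χ.LFunction β = 0) :
    ‖χ.LFunction 1‖ ≤ 55 * (1 - β) * Real.log q ^ 2 := by
  have hq8 : (8 : ℝ) ≤ q := by exact_mod_cast hq
  have hq0 : (0 : ℝ) < q := by linarith
  have hL2 : 2 < Real.log q := by
    have h8 : 2 < Real.log 8 := by
      rw [show (8 : ℝ) = 2 ^ 3 by norm_num, Real.log_pow]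
      have := Real.log_two_gt_d9; push_cast; linarith
    exact lt_of_lt_of_le h8 (Real.log_le_log (by norm_num) hq8)
  have hL0 : 0 < Real.log q := by linarith
  set r : ℝ := 1 / (4 * Real.log q) with hrdef
  have hr0 : 0 < r := by positivity
  have hr8 : r ≤ 1 / 8 := by
    rw [hrdef, div_le_div_iff₀ (by positivity) (by norm_num)]; linarith
  have hβr : 1 - r ≤ β := by rw [hrdef]; exact hβ
  have hmv := norm_LFunction_one_le χ hχ hr0 hr8 hβr hzero
  have hβ1 : β < 1 := by
    by_contra hcon
    exact DirichletCharacter.LFunction_ne_zero_of_one_le_re χ (Or.inl hχ) (s := β)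
      (by simp; linarith) hzero
  have hq4r : (q : ℝ) ^ (4 * r) = Real.exp 1 := by
    rw [hrdef, Real.rpow_def_of_pos hq0]
    congr 1; field_simp
  have he : Real.exp 1 < 2.72 := by
    have := Real.exp_one_lt_d9; linarith
  have h2r : 1 + 1 / (2 * r) = 1 + 2 * Real.log q := by rw [hrdef]; field_simp; ring
  have hfac : 2 * (q : ℝ) ^ (4 * r) * (1 + 1 / (2 * r)) / r ≤ 55 * Real.log q ^ 2 := by
    rw [hq4r, h2r, hrdef, div_div_eq_mul_div, div_one]
    have h1 : 1 + 2 * Real.log q ≤ 5 / 2 * Real.log q := by linarith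
    have hpos : 0 ≤ 2 * Real.exp 1 := by positivity
    nlinarith [Real.exp_pos 1, mul_le_mul_of_nonneg_left h1 hpos]
  have h1β : 0 ≤ 1 - β := by linarith
  calc ‖χ.LFunction 1‖ ≤ (1 - β) * (2 * (q : ℝ) ^ (4 * r) * (1 + 1 / (2 * r)) / r) := hmv
    _ ≤ (1 - β) * (55 * Real.log q ^ 2) := mul_le_mul_of_nonneg_left hfac h1β
    _ = 55 * (1 - β) * Real.log q ^ 2 := by ring

/-- **Quality ⇒ small `η(D)`, explicitly**: a Siegel zero of quality `η` (Tao–Teräväinen,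
`β = 1 − 1/(η log q)`, `η ≥ 10`) attached to `χ` mod `q ≥ 8` forces
`η(χ) := ‖L(1, χ)‖ · log q ≤ 55 (log q)²/η`. So `η ≥ 55 (log q)²/ε` gives Friedlander–Iwaniec's
`η(χ) ≤ ε` for THIS character (the explicit, single-character form of the morning's
`Ford2020.PolylogExceptionalZeros.smallEtaCharacters`). [cite: TaoTeravainen2021, Definition 1.4]
[cite: MontgomeryVaughan2007, Theorem 11.4 (11.10)] [cite: FriedlanderIwaniec2019TwinPrimes, (1.6)] -/
theorem isSiegelZero_eta_le {q : ℕ} [NeZero q] (hq : 8 ≤ q) {χ : DirichletCharacter ℂ q} {η : ℝ}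
    (hS : IsSiegelZero χ η) : ‖χ.LFunction 1‖ * Real.log q ≤ 55 * Real.log q ^ 2 / η := by
  obtain ⟨hprim, hquad, h10, hzero⟩ := hS
  have hq8 : (8 : ℝ) ≤ q := by exact_mod_cast hq
  have hL0 : 0 < Real.log q := Real.log_pos (by linarith)
  have hη : 0 < η := by linarith
  have hne : χ ≠ 1 := ne_one_of_isPrimitive (by omega) hprim
  -- `β = 1 − 1/(η log q) ≥ 1 − 1/(4 log q)` since `η ≥ 10 ≥ 4`
  have hβ : 1 - 1 / (4 * Real.log q) ≤ 1 - 1 / (η * Real.log q) := by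
    have : 1 / (η * Real.log q) ≤ 1 / (4 * Real.log q) :=
      one_div_le_one_div_of_le (by positivity) (by nlinarith)
    linarith
  have h := norm_LFunction_one_le_mul_log_sq hq χ hne hβ hzero
  have h1β : 1 - (1 - 1 / (η * Real.log q)) = 1 / (η * Real.log q) := by ring
  rw [h1β] at h
  -- `‖L(1,χ)‖ ≤ 55 (1/(η log q)) (log q)² = 55 log q/η`
  have h' : ‖χ.LFunction 1‖ ≤ 55 * Real.log q / η := by
    calc ‖χ.LFunction 1‖ ≤ 55 * (1 / (η * Real.log q)) * Real.log q ^ 2 := h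
      _ = 55 * Real.log q / η := by field_simp
  calc ‖χ.LFunction 1‖ * Real.log q ≤ (55 * Real.log q / η) * Real.log q :=
        mul_le_mul_of_nonneg_right h' hL0.le
    _ = 55 * Real.log q ^ 2 / η := by ring

/-- **Explicit threshold for Friedlander–Iwaniec's smallness**: a Siegel zero of quality
`η ≥ 55 (log q)²/ε` at a conductor `q ≥ 8` gives `‖L(1, χ)‖ log q ≤ ε`. [cite: TaoTeravainen2021, Definition 1.4]
[cite: FriedlanderIwaniec2019TwinPrimes, (1.6)] -/
theorem isSiegelZero_eta_le_of_quality_ge {q : ℕ} [NeZero q] (hq : 8 ≤ q)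
    {χ : DirichletCharacter ℂ q} {η ε : ℝ} (hS : IsSiegelZero χ η) (hε : 0 < ε)
    (hηε : 55 * Real.log q ^ 2 / ε ≤ η) : ‖χ.LFunction 1‖ * Real.log q ≤ ε := by
  have hη : 0 < η := by linarith [hS.ten_le]
  have h := isSiegelZero_eta_le hq hS
  have hq8 : (8 : ℝ) ≤ q := by exact_mod_cast hq
  have hL0 : 0 < Real.log q := Real.log_pos (by linarith)
  have : 55 * Real.log q ^ 2 / η ≤ ε := by
    rw [div_le_iff₀ hη]
    have := (div_le_iff₀ hε).mp hηε
    linarith [mul_comm η ε]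
  exact h.trans this


/-- **Effective location of high-quality Siegel zeros**: a Siegel zero of quality `η` attached to a
conductor `q ≥ 3` has `q ≥ η/800` (from `η ≤ 400 √q log q` and `log q ≤ 2√q`). So the witnesses of
`UnboundedSiegelZeros` of quality `≥ η₀` all lie above conductor `η₀/800` — an EFFECTIVE, kernel
form of the tail-only reading `UnboundedSiegelZeros.exists_witness_above`.
[cite: TaoTeravainen2021, Definition 1.4 and (1.4)] [cite: DavenportMNT1980, Ch. 14 (12)] -/
theorem isSiegelZero_conductor_ge {q : ℕ} [NeZero q] (hq : 3 ≤ q) {χ : DirichletCharacter ℂ q}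
    {η : ℝ} (hS : IsSiegelZero χ η) : η / 800 ≤ q := by
  have h := isSiegelZero_quality_le hq hS
  have hq3 : (3 : ℝ) ≤ q := by exact_mod_cast hq
  have hq0 : (0 : ℝ) < q := by linarith
  have hsq : 0 < Real.sqrt q := Real.sqrt_pos.mpr hq0
  -- `log q = 2 log √q ≤ 2 (√q − 1) < 2 √q`
  have hlog : Real.log q ≤ 2 * Real.sqrt q := by
    have h1 : Real.log (Real.sqrt q) ≤ Real.sqrt q - 1 := Real.log_le_sub_one_of_pos hsq
    have h2 : Real.log q = 2 * Real.log (Real.sqrt q) := by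
      rw [Real.log_sqrt hq0.le]; ring
    linarith
  have hqq : Real.sqrt q * Real.sqrt q = q := Real.mul_self_sqrt hq0.le
  rw [div_le_iff₀ (by norm_num : (0 : ℝ) < 800)]
  calc η ≤ 400 * Real.sqrt q * Real.log q := h
    _ ≤ 400 * Real.sqrt q * (2 * Real.sqrt q) :=
        mul_le_mul_of_nonneg_left hlog (by positivity)
    _ = (q : ℝ) * 800 := by nlinarith [hqq]

end RealZeroRepulsion

end Literature.NumberTheory.LFunctions

end
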